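import Summits.QuantumFields.YangMills.Theorems.FluctuationComparisonRegPrIntLOrganTangentAPackageFromHeight
import Summits.QuantumFields.YangMills.Theorems.BalabanUVNodesN07AveragingLocalContinuity
import Literature.MathematicalPhysics.QuantumFieldTheory.Balaban1983to89.LatticeWordStokes
import HarnessLib

/-!
# `FluctuationComparisonRegPrIntLOrganTangentModeLettersFromHeight` — (L9) THE CHART LETTERS OF THE MODE∘ KNIT, FROM A HEIGHT:
# `ContinuousOn (descend F ℰp j) {PlaqSmall θ_{j+1}}` and the per-bond `(T, θ)` with `hTo hθc hright hsol` at the FULL window `a := θ_{j+1}` — the displayed letters of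
# ✓`…OrganTangentModeSectionKnit.modeSection_of_uniqueFibreMax` (LEAD w3 g23) other than UNIQ-MAX∘ and the frame's `hr′` — hold for every family from a height

Cell `ym3-torus` (rung R3 = continuum `SU(2)` Yang–Mills on T³ — NOT d = 4, NOT infinite volume, NOT a mass gap, NOT Clay), width seat `ym-ust-20520-w5` (gen 21), pen (L9).
`--kind proof --supports stmt-QuantumFields-20520 --as helper`, count-neutral, definition-free, default heartbeats; THEOREMS ONLY; nothing printed is asserted.

§1 `continuousOn_descend_of_small` — the T³ descent is continuous on `{PlaqSmall a}` once `((d+2)L)²∕4·a < δ₂` (pub-ymgap ✓`N07AveragingLocalContinuity.continuousAt_avgFun_apply_of_small`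
+ lit ✓`LatticeWordStokes.small_of_plaqSmall` + ✓(L6a) `descend_apply`).  §2 ★★★ `exists_height_modeLetters`: for every `F`, `0 < γ ≤ 1`, `0 < b₀` (any `p₀`) there is `jB` with,
for all `j ≥ jB`: `ContinuousOn (descend F ℰp j) {PlaqSmall θ_{j+1}}` and `∃ T θ` with `hTo`, `hθc`, `hright`, `hsol` (at `PlaqSmall θ_{j+1}`, `∈ T c U` form) — ✓(L6b) `oneBondData` at
`a := θ_{j+1}` and the constants of ✓(L8), the height from ✓`tendsto_θBal_atTop`.  So MODE∘ ⟸ UNIQ-MAX∘ ∧ `hr′` alone, from a height.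
NOT HERE: UNIQ-MAX∘ (the one-well letter), MODE∘∕TRM∘∕LAP∕LIN∘∕JEN∘∕O1∕crux 20520∕`YM3TorusSU2`.  No `def`, `instance`, `sorry`.
-/

set_option autoImplicit false

noncomputable section

namespace Summit.QuantumFields.YangMills.Theorems.FluctuationComparisonRegPrIntLOrganTangentModeLettersFromHeight

open Set Function Filter Topology MeasureTheory
open scoped ENNReal NNReal
open Literature.MathematicalPhysics.QuantumFieldTheory.Balaban1983to89
open Literature.MathematicalPhysics.QuantumFieldTheory.Balaban1983to89.T3OrbitAverage
open T3ContinuumYM3Torus T3NestedUnitLaws T3UnitLawDensityEML T3UnitScaleTilt T3LevelShift T4Continuum AveragingRT BlockAveraging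
open Literature.MathematicalPhysics.QuantumFieldTheory.Balaban1983to89.BlockAveragingHaarAC (centralBond IsCentral)
open Literature.MathematicalPhysics.QuantumFieldTheory.Balaban1983to89.BlockAveragingEMLHaarAC (offCard)
open ExpMeanLog (expMeanLogSU deltaSU deltaSU_pos)
open Summit.QuantumFields.YangMills.Theorems.FluctuationComparisonRegPrIntLOrganTangentOneBondAtDescend (descend_apply)
open Summit.QuantumFields.YangMills.Theorems.FluctuationComparisonRegPrIntLOrganTangentOneBondData (oneBondData)
open Summit.QuantumFields.YangMills.Theorems.FluctuationComparisonRegPrIntLOrganTangentAPackageFromHeight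
  (torus_d_L not_isCentral_corner offCard_div_card_le filterCard_eq_offCard)
open Summit.QuantumFields.YangMills.BalabanUVNodes.N07AveragingLocalContinuity (continuousAt_avgFun_apply_of_small)

/-! ## §1 Window-continuity of the descent -/

/-- **THE T³ DESCENT IS CONTINUOUS ON SMALL FIELDS**: if `((d+2)L)²∕4·a < δ₂` then `descend F ℰp j` is continuous on `{PlaqSmall a}` (every (0.4) loop variable is inside
the guard, where the average is `E(loop variables)·U(c)` with `E` continuous). [cite: Balaban1987RG1, (0.4) p.253; Balaban1985Averaging, Prop. 1 (51) p.26] -/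
theorem continuousOn_descend_of_small (F : T3Family) (j : ℕ) {a : ℝ} (ha : 0 ≤ a)
    (hta : (((((F.P (j + 1)).d + 2) * (F.P (j + 1)).L : ℕ) : ℝ) ^ 2 / 4) * a < deltaSU (Fin 2)) :
    ContinuousOn (descend F ℰp j : GaugeField (F.P (j + 1)) 0 ↥(Matrix.specialUnitaryGroup (Fin 2) ℂ) → GaugeField (F.P j) 0 ↥(Matrix.specialUnitaryGroup (Fin 2) ℂ)) {U | PlaqSmall a U} := by
  refine continuousOn_pi.2 fun c => ?_
  intro U₀ hU₀
  have hsmall : Small (expMeanLogSU (n := Fin 2)) U₀ (bondShift (sitesPerDir_descend F j 0) c) :=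
    LatticeWordStokes.small_of_plaqSmall (expMeanLogSU (n := Fin 2)) ha hU₀ hta _
  have h := continuousAt_avgFun_apply_of_small (N := 2) (bondShift (sitesPerDir_descend F j 0) c) hsmall
  have hfun : (fun U : GaugeField (F.P (j + 1)) 0 ↥(Matrix.specialUnitaryGroup (Fin 2) ℂ) => descend F ℰp j U c) =
      fun U : GaugeField (F.P (j + 1)) 0 ↥(Matrix.specialUnitaryGroup (Fin 2) ℂ) => avgFun (expMeanLogSU (n := Fin 2)) U (bondShift (sitesPerDir_descend F j 0) c) := funext fun U => descend_apply F j U c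
  show ContinuousWithinAt (fun U : GaugeField (F.P (j + 1)) 0 ↥(Matrix.specialUnitaryGroup (Fin 2) ℂ) => descend F ℰp j U c) {U | PlaqSmall a U} U₀
  rw [hfun]
  exact h.continuousWithinAt

/-! ## §2 The MODE∘ chart letters from a height -/

/-- ★★★ **THE CHART LETTERS OF THE MODE∘ KNIT HOLD FROM A HEIGHT** (see the module docstring): for all `j ≥ jB`, window-continuity of `descend` at radius `θ_{j+1}` and
per-bond `(T, θ)` with `hTo`, `hθc`, `hright`, `hsol` at the full window. [cite: Balaban1987RG1, (0.4) p.253 and (2.10) p.267; Balaban1985Averaging, (10)-(13) p.19] -/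
theorem exists_height_modeLetters
    (F : T3Family) (γ b₀ p₀ : ℝ) (hγ : 0 < γ) (hγ1 : γ ≤ 1) (hb₀ : 0 < b₀) :
    ∃ jB : ℕ, ∀ (j : ℕ), jB ≤ j →
      ContinuousOn (descend F ℰp j : GaugeField (F.P (j + 1)) 0 ↥(Matrix.specialUnitaryGroup (Fin 2) ℂ) → GaugeField (F.P j) 0 ↥(Matrix.specialUnitaryGroup (Fin 2) ℂ)) {U | PlaqSmall (θBal F.L γ b₀ p₀ (j + 1)) U} ∧
      ∃ (T : PBond (F.P j) 0 → GaugeField (F.P (j + 1)) 0 ↥(Matrix.specialUnitaryGroup (Fin 2) ℂ) → Set ↥(Matrix.specialUnitaryGroup (Fin 2) ℂ))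
        (θ : PBond (F.P j) 0 → GaugeField (F.P (j + 1)) 0 ↥(Matrix.specialUnitaryGroup (Fin 2) ℂ) → ↥(Matrix.specialUnitaryGroup (Fin 2) ℂ) → ↥(Matrix.specialUnitaryGroup (Fin 2) ℂ)),
        (∀ c U, IsOpen (T c U)) ∧
        (∀ c U, ContinuousOn (θ c U) (T c U)) ∧
        (∀ c U, ∀ v ∈ T c U, descend F ℰp j (update U (centralBond (bondShift (sitesPerDir_descend F j 0) c)) (θ c U v)) c = v) ∧
        (∀ U : GaugeField (F.P (j + 1)) 0 ↥(Matrix.specialUnitaryGroup (Fin 2) ℂ), PlaqSmall (θBal F.L γ b₀ p₀ (j + 1)) U →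
          ∀ c, descend F ℰp j U c ∈ T c U ∧ θ c U (descend F ℰp j U c) = U (centralBond (bondShift (sitesPerDir_descend F j 0) c))) := by
  classical
  have hL3 : (3 : ℝ) ≤ F.L := by exact_mod_cast (torus_d_L F 0).2.2
  set δ : ℝ := deltaSU (Fin 2) with hδ
  have hδ0 : 0 < δ := deltaSU_pos
  have hcard : ∀ j : ℕ, (Fintype.card (Idx (F.P (j + 1))) : ℝ) = (Fintype.card (Idx (F.P 1)) : ℝ) := fun j => rfl
  set ε : ℝ := ((Fintype.card (Idx (F.P 1)) : ℝ))⁻¹ with hε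
  have hN0 : (0 : ℝ) < Fintype.card (Idx (F.P 1)) := by exact_mod_cast Fintype.card_pos
  have hε0 : 0 < ε := inv_pos.2 hN0
  have hε1 : ε ≤ 1 := inv_le_one_of_one_le₀ (by exact_mod_cast Fintype.card_pos)
  -- radii (as in (L8))
  set α₀ : ℝ := min (min (1 / 48) (δ / 64)) (ε / 300) with hα₀
  have hα₀pos : 0 < α₀ := by simp only [hα₀, lt_min_iff]; exact ⟨⟨by norm_num, by positivity⟩, by positivity⟩
  have hα₁ : α₀ ≤ 1 / 48 := (min_le_left _ _).trans (min_le_left _ _)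
  have hα₂ : α₀ ≤ δ / 64 := (min_le_left _ _).trans (min_le_right _ _)
  have hα₄ : α₀ ≤ ε / 300 := min_le_right _ _
  set ρ : ℝ := α₀ * ε / 4 with hρ
  set s : ℝ := ε * ρ / 8 with hs
  set d₀ : ℝ := α₀ - ρ - s with hd₀
  set ρ'' : ℝ := ε * ρ / 4 with hρ''
  have hρpos : 0 < ρ := by positivity
  have hspos : 0 < s := by positivity
  have hρα : ρ ≤ α₀ / 4 := by
    have h := mul_le_mul_of_nonneg_left hε1 hα₀pos.le; rw [hρ]; linarith
  have hsρ : s ≤ ρ / 8 := by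
    have h := mul_le_mul_of_nonneg_right hε1 hρpos.le; rw [hs]; linarith
  have hd₀pos : 0 < d₀ := by rw [hd₀]; linarith
  have hsum : s + ρ + d₀ = α₀ := by rw [hd₀]; ring
  have hρ''pos : 0 < ρ'' := by positivity
  -- threshold and height: `t = (25∕4)L²·θ_{j+1} < min (min δ (s∕2)) (min (ρ″∕14) ρ)`
  set τ : ℝ := min (min δ (s / 2)) (min (ρ'' / 14) ρ) / (7 * (F.L : ℝ) ^ 2 + 1) with hτ
  have hτpos : 0 < τ := by positivity
  have hθ := (T3ThresholdSmallness.tendsto_θBal_atTop F.hL.2 hγ b₀ p₀).eventually (gt_mem_nhds hτpos)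
  obtain ⟨j₁, hj₁⟩ := eventually_atTop.1 hθ
  refine ⟨j₁, fun j hj => ?_⟩
  have hθj : θBal F.L γ b₀ p₀ (j + 1) < τ := hj₁ (j + 1) (by omega)
  have hθpos : 0 < θBal F.L γ b₀ p₀ (j + 1) := T3MinimiserStabilityReduction.θBal_pos (by have := F.hL.2; omega) hγ hγ1 hb₀ p₀ (j + 1)
  have ht_eq : (((((F.P (j + 1)).d + 2) * (F.P (j + 1)).L : ℕ) : ℝ) ^ 2 / 4) * θBal F.L γ b₀ p₀ (j + 1) =
      25 / 4 * (F.L : ℝ) ^ 2 * θBal F.L γ b₀ p₀ (j + 1) := by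
    have : ((F.P (j + 1)).d + 2) * (F.P (j + 1)).L = 5 * F.L := rfl
    rw [this]; push_cast; ring
  have htlt : 25 / 4 * (F.L : ℝ) ^ 2 * θBal F.L γ b₀ p₀ (j + 1) < min (min δ (s / 2)) (min (ρ'' / 14) ρ) := by
    have h := mul_lt_mul_of_pos_left hθj (show (0 : ℝ) < 7 * (F.L : ℝ) ^ 2 by positivity)
    have h' : (7 * (F.L : ℝ) ^ 2 + 1) * τ = 7 * (F.L : ℝ) ^ 2 * τ + τ := by ring
    have h2 : (7 * (F.L : ℝ) ^ 2 + 1) * τ = min (min δ (s / 2)) (min (ρ'' / 14) ρ) := by rw [hτ, mul_div_cancel₀ _ (by positivity)]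
    have h3 : 25 / 4 * (F.L : ℝ) ^ 2 * θBal F.L γ b₀ p₀ (j + 1) ≤ 7 * (F.L : ℝ) ^ 2 * θBal F.L γ b₀ p₀ (j + 1) := by nlinarith [sq_nonneg (F.L : ℝ), hθpos.le]
    linarith
  have htδ : 25 / 4 * (F.L : ℝ) ^ 2 * θBal F.L γ b₀ p₀ (j + 1) < δ := htlt.trans_le ((min_le_left _ _).trans (min_le_left _ _))
  have hts : 25 / 4 * (F.L : ℝ) ^ 2 * θBal F.L γ b₀ p₀ (j + 1) < s / 2 := htlt.trans_le ((min_le_left _ _).trans (min_le_right _ _))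
  have htρ'' : 25 / 4 * (F.L : ℝ) ^ 2 * θBal F.L γ b₀ p₀ (j + 1) < ρ'' / 14 := htlt.trans_le ((min_le_right _ _).trans (min_le_left _ _))
  have htρ : 25 / 4 * (F.L : ℝ) ^ 2 * θBal F.L γ b₀ p₀ (j + 1) < ρ := htlt.trans_le ((min_le_right _ _).trans (min_le_right _ _))
  have hμ : ∀ c : PBond (F.P j) 0, (offCard (bondShift (sitesPerDir_descend F j 0) c) : ℝ) / (Fintype.card (Idx (F.P (j + 1))) : ℝ) ≤ 1 - ε :=
    fun c => by rw [hε, ← hcard j]; exact offCard_div_card_le F (j + 1) 0 _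
  refine ⟨continuousOn_descend_of_small F j hθpos.le (by rw [ht_eq]; exact htδ), ?_⟩
  obtain ⟨T, T', θ, hTo, -, hT'T, hright, -, hθc, hsol, -, -, -, -, -, -, -⟩ :=
    oneBondData F j _ (fun c => not_isCentral_corner F (j + 1) 0 (bondShift (sitesPerDir_descend F j 0) c))
      (s := s) (ρ := ρ) (d₀ := d₀) (ρ'' := ρ'') (a := θBal F.L γ b₀ p₀ (j + 1))
      hspos hρpos.le hd₀pos (by rw [hsum]; linarith) (by rw [hsum]; linarith)
      (fun c => by rw [filterCard_eq_offCard, hsum]; linarith [hμ c])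
      hρ''pos
      (fun c => by
        rw [filterCard_eq_offCard]
        have hμc := hμ c
        have hsr0 : 0 ≤ s + ρ := by positivity
        have h1 : (offCard (bondShift (sitesPerDir_descend F j 0) c) : ℝ) / (Fintype.card (Idx (F.P (j + 1))) : ℝ) * (s + ρ) ≤ s + ρ - ε * ρ := by
          have h := mul_le_mul_of_nonneg_right hμc hsr0
          have h' : (1 - ε) * (s + ρ) = s + ρ - ε * s - ε * ρ := by ring
          rw [h'] at h; linarith [mul_nonneg hε0.le hspos.le]
        have h2 : (s + ρ) ^ 2 ≤ 81 / 64 * ρ ^ 2 := by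
          have hle : s + ρ ≤ 9 / 8 * ρ := by linarith
          have h := mul_le_mul hle hle hsr0 (by positivity)
          have h' : 9 / 8 * ρ * (9 / 8 * ρ) = 81 / 64 * ρ ^ 2 := by ring
          rw [← pow_two, h'] at h; exact h
        have hρε : ρ ≤ ε / 192 := by
          have h := mul_le_mul_of_nonneg_right hα₁ hε0.le; rw [hρ]; linarith
        have h3 : ρ ^ 2 ≤ ε * ρ / 192 := by
          have h := mul_le_mul_of_nonneg_left hρε hρpos.le
          have h' : ρ * (ε / 192) = ε * ρ / 192 := by ring
          rw [pow_two, ← h']; exact h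
        have h4 : 0 < ε * ρ := mul_pos hε0 hρpos
        rw [hρ'']; rw [hs] at h1 h2 ⊢; linarith)
      hθpos.le (by rw [ht_eq]; exact htδ) (by rw [ht_eq]; linarith) (by rw [ht_eq]; exact htρ.le) (by rw [ht_eq]; linarith)
  exact ⟨T, θ, hTo, hθc, hright, fun U hU c => ⟨subset_closure.trans (hT'T c U) (hsol U hU c).1, (hsol U hU c).2⟩⟩

end Summit.QuantumFields.YangMills.Theorems.FluctuationComparisonRegPrIntLOrganTangentModeLettersFromHeight

end
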